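import Summits.ABC.IUTFork.Cor312LicenceTripleHullCellRefute
import Summits.ABC.IUTFork.Conditional.AbcOfSGenuineKLinUniformRows6
import HarnessLib

/-!
# R-W WINDOW-TABLE «W:GAP-1019» — the abc triple `7¹¹·19 + 5¹²·1019·7151² = 2²⁸·3¹²·11³·67` at its ONE Szpiro-bad level in the gap between the
# [LIN] band (`l ≤ 480`) and the inhabited certificate: at `l = 1019` the hull licence S_H FAILS at every genuine Θ-volume datum whose local
# type at `7` carries NO twist factor (`e(K_x/ℚ₇) ∣ 15·l`, i.e. `e = 15·l`) — the deciding packet is `(p, j) = (7, 509)`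

PROOF-ONLY file (D-0012; 0 definitions, 0 `Prop` facts, no instance) of the abc-iut cell — D-0079 RESCUE sub-cell R-W «WINDOW Θ-SIDE
INEQUALITY», seat abc-iut-w5-d009 (gen 14), row «W:GAP-1019» (abc-iut-W-num-5 g3's census 2026-08-27T02:47:45Z: the complete Szpiro-bad admissible
set of this triple is `{17, …, 127, 1019, 7151}`; the 25 levels `l ≤ 127` are REFUTED by abc-iut-w5-d107's [LIN]-uniform band
`GenuineK.not_pilotKummerCompatHull_chosen_frey37569208117_band` (`15 ≤ l ≤ 480`, p464182 engine); `7151 ≥ 1663` is inside the inhabited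
certificate; `1019` lies in the gap `(480, 1663)` where neither the [LIN]/[ED] engines nor the floor-free inhabited cells decide). Over this seat's
negative triple socket `WRow.not_licence_triple_of_not_hullCell` (`Cor312LicenceTripleHullCellRefute`; abc-iut-rh-typ-4's floor-exact hull
column `HullCell` p458452 / p462895). TAKES NO SIDE on [IUTchIII] Cor. 3.12 (S. Mochizuki, *Inter-universal Teichmüller theory III*, Cor. 3.12
p. 173–174; Step (xi-f) p. 184) or on any author; «refuted as typed» ≠ «refuted in print».

THE ARITHMETIC (desk file work/cells1019.py of this seat reproduces the R-W numerics lead's `margin_U2cell` column, e.g. `−49687` at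
`(l, p, e) = (67, 7, 1005)`). At `l = 1019` every bad prime `p ≠ 7` passes the exact U2 diagonal cell with margin `≥ 31583` at every label and
every admissible local type; at `p = 7` (`v₇(abc) = 11`, `P_q = e·22/(2l)`) the local type is `e ∈ {15·l, 30·l}` (abc-iut-W-neg-1: `15·l ∣ 11·e`,
`e ∣ 30·l`; §1) and the two candidates DISAGREE: `e = 15·l = 15285` (`P_q = 165`, inner radius exponent `≤ ⌊e/6⌋+1 = 2548`, exact envelope
`r_out = 7⁵ − 5e = −59618`): `15285·⌊(509²·165 − 509·15284 − 510·2548)/15285⌋ = 33657570 > 165 + 510·59618 = 30405345` — the column FAILS at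
the top label `j = 509` (margin `−3252225`; it fails at the 39 labels `471 ≤ j ≤ 509`), whereas `e = 30·l` passes at every label (margin
`≥ 333556`, inner slot `⌊e/6⌋ = 5095`, `r_out = 7⁵ − 5e = −136043`; filed separately on the inhabited side). The [LIN]-uniform test cannot fire
here: `30·l = 30570 > 7⁴·6 = 14406` forces print's `b ≤ B − 1/e` with `B = 5`, and `(i₀+2)(B+1+1/5) + 1 ≤ (11/l)·i₀(i₀+2)` needs `i₀ ≥ 574 > 508`
— the band top `480 = ⌊14406/30⌋` is exactly the last level with `B = 4`.

WHAT IS PROVED (namespace `Summit.ABC.IUTFork.Conditional`):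
* §1 `WRow.factorization_frey37569208117_seven` (`v₇ = 11`); **`WRow.localType_seven_frey37569208117`** — at ANY prime level `l ∉ {7, 11}`, every
  fibre point `x₀ | 7` of a genuine datum over the triple has `e(K_{x₀}/ℚ₇) = 15·l ∨ e(K_{x₀}/ℚ₇) = 30·l`, and `7 ∤ e` (abc-iut-W-neg-1's
  `GenuineK.fifteen_mul_prime_dvd_absRamificationIdx_kOf_mul_ratPoint`, `ramificationIdx_int_dvd_thirty_mul_ratPoint'`,
  `GenuineK.absRamificationIdx_kOf_dvd_ratPoint` BY NAME).
* §2 **`WRow.not_licence_frey37569208117_gap1019_of_fifteen`** — `l = 1019`, EVERY genuine Θ-volume datum `T` at `(ratPoint (a/c), 1019)` whose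
  places over `7` have `e(K_x/ℚ₇) ∣ 15·1019`, EVERY pair of realising Θ- and q-ideles: `¬ Thm311ToCor312.Licence (settingPrVolSharp (pilotDataOfK
  T.D T.K) …)`; **`WRow.not_exists_qPinned_and_hull_frey37569208117_gap1019_of_fifteen`** — branch C's antecedent «∃ ρ qK, QPinned ∧
  PilotKummerCompatHull» FAILS there (any columns); **`GenuineK.not_pilotKummerCompatHull_chosen_frey37569208117_gap1019_of_fifteen`** — the
  instance shape of the W-lane refutations (chosen ideles, pinned reading, every free binder).
READING (neutral; numbers, not adjectives): at the datum class `(ratPoint (7¹¹·19/c), 1019)` OUR typed window clause S_H is NOT a function of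
`(λ, l)`: it is REFUTED on the sub-class «no twist factor at 7» (this file) and INHABITED on the sub-class «twist factor at 7» (`e = 30·l`; the
companion file). Which sub-class a datum lands in is decided by its field `F` inside print's range `ℚ(√−1, E_λ[15]) ⊆ F ⊆ F‡ = ℚ(√−1, √λ, √(λ−1),
E_λ[15])` ([IUTchIV] Thm. 1.10 p. 22 «F = F_tpd(√−1, E_{F_tpd}[3·5])»; the cell's `Cor22.IsSubThetaField`): `ord₇ λ = 11` is ODD, so `√λ`
ramifies at `7` (abc-iut-w4-d087's parity lemma `GenuineK.absRamificationIdx_kOf_dvd_fifteen_mul_ratPoint` needs BOTH `ord_p λ`, `ord_p(λ−1)`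
even and does not apply) — desk reading, NOT a theorem of this file: the local type is taken as a HYPOTHESIS on `T`. Admissibility /
Szpiro-badness / (P6) / NON-EMPTINESS of either sub-class are NOT claimed. HONEST SCOPE: OUR sharp containers; STRONGER-THAN-PRINT hull reading;
nothing about the printed inequality, the number-level corollary or any author's intended hull; typed ≠ proved; instantiated ≠ endorsed; no abc
claim. [cite: Mochizuki2012, IUTchI Def. 3.1 (b),(c) pp. 61–62, Ex. 3.2 (iv) p. 71; IUTchIII Cor. 3.12 Step (xi-f) p. 184; IUTchIV Prop. 1.1 p. 9, Prop. 1.2 (i)(ii) p. 10, Thm. 1.10 p. 22, Cor. 2.2 (ii) proof (P5) p. 46]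
[cite: DupuyHilado2025, §3.3, §3.4, §4.9, §4.12] [cite: SilvermanATAEC1994, V.5 Thm. 5.3 and Cor. 5.4] [cite: SerreLocalFields1979, Ch. III §6 Prop. 13]
[claim: Mochizuki2012, status: disputed] for every IUT sentence.
-/

noncomputable section

open Set Function Metric NumberField IsDedekindDomain

namespace Summit.ABC.IUTFork.Conditional

open Thm311 Thm311.Real Cor312 Cor312Vol Cor312Prov Literature.IUT.LogThetaLattice Literature.IUT.LogVolume
  Literature.IUT.HodgeTheaters Literature.IUT.LogVolume.Cor22 Literature.IUT.LogVolume.ThetaData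
open Literature.NumberTheory.NumberFields Literature.NumberTheory.GaloisRepresentations.Ultrametric
open Literature.NumberTheory.DiophantineGeometry Literature.NumberTheory.DiophantineGeometry.GenEll
open Summit.ABC.IUTFork.Repair.RH.HullThresholdExact Summit.ABC.IUTFork.Repair.RH.HullThresholdExactRefute

/-! ## §1. The pole order at `7` and the local type `e ∈ {15·l, 30·l}` at every fibre point over `7` -/

/-- `v_p(n) = k` from `n = p^k·m` with `p ∤ m`. [folklore] -/
private theorem factorization_eq_of_eq_pow_mul₇ {p k m n : ℕ} (hp : p.Prime) (hn : n = p ^ k * m) (hm : ¬ p ∣ m) :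
    n.factorization p = k := by
  subst hn
  have hm0 : m ≠ 0 := fun h => hm (h ▸ dvd_zero p)
  rw [Nat.factorization_mul (pow_ne_zero _ hp.ne_zero) hm0, Finsupp.add_apply, hp.factorization_pow, Finsupp.single_eq_same,
    Nat.factorization_eq_zero_of_not_dvd hm, add_zero]

/-- `v₇(abc) = 11` for `abc = (7¹¹·19)·(5¹²·1019·7151²)·(2²⁸·3¹²·11³·67)`. [folklore] -/
theorem WRow.factorization_frey37569208117_seven :
    (7 ^ 11 * 19 * (5 ^ 12 * 1019 * 7151 ^ 2) * (2 ^ 28 * 3 ^ 12 * 11 ^ 3 * 67)).factorization 7 = 11 :=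
  factorization_eq_of_eq_pow_mul₇ (m := 3075028791823382347197775872000000000000) (by norm_num) (by norm_num) (by norm_num)

/-- **The pole of `j` at `7`**: at every place `v` of `ℚ` over `7`, `ord_v j(7¹¹·19 / c) = −22`. [cite: SilvermanAEC2009, Prop. III.1.7(b)] -/
theorem WRow.ord_jInv_frey37569208117_seven (v : HeightOneSpectrum (𝓞 ℚ)) (hv : Rat.HeightOneSpectrum.natGenerator v = 7) :
    ord ℚ v (jInv (((7 ^ 11 * 19 : ℕ) : ℚ) / (2 ^ 28 * 3 ^ 12 * 11 ^ 3 * 67 : ℕ))) = -(2 * ((11 : ℕ) : ℤ)) := by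
  rw [Cor22.ord_jInv_ratPoint_triple_eq isABCTriple_frey37569208117 v (by rw [hv]; norm_num)
    (by rw [hv]; norm_num), hv, WRow.factorization_frey37569208117_seven]

/-- **The local type at `7` of a genuine datum over the triple, any prime level `l ∉ {7, 11}`**: every fibre point `x₀ | 7` has
`e(K_{x₀}/ℚ₇) ∈ {15·l, 30·l}` and `7 ∤ e(K_{x₀}/ℚ₇)` — abc-iut-W-neg-1's lower bound `15·l ∣ e·11` (`l ≠ 11`), upper bound `e ∣ 30·l` and
`7 ∤ e`, BY NAME. (Both values occur across print's range of `F`: `√λ` ramifies at `7` since `ord₇ λ = 11` is odd — desk reading, not used.)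
[cite: SilvermanATAEC1994, V.5 Thm. 5.3 and Cor. 5.4] [cite: Mochizuki2012, IUTchIV Thm. 1.10 proof Steps (ii)–(iii) p. 24–26] [claim: Mochizuki2012, status: disputed] -/
theorem WRow.localType_seven_frey37569208117 {l : ℕ} (hl : l.Prime) (hl7 : l ≠ 7) (hl11 : l ≠ 11)
    (T : Cor22.ThetaVolumeDatumAt (ratPoint (((7 ^ 11 * 19 : ℕ) : ℚ) / (2 ^ 28 * 3 ^ 12 * 11 ^ 3 * 67 : ℕ))) l) :
    letI := T.instFieldF; letI := T.instNumberFieldF; letI := T.instAlgebraF; letI := T.instFieldK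
    letI := T.instNumberFieldK; letI := T.instAlgebraK; letI := T.instFieldFbar; letI := T.instAlgebraFbar
    letI := T.instAlgebraKFbar; letI := T.instIsElliptic
    haveI : Fact (Nat.Prime 7) := ⟨by norm_num⟩
    ∀ x₀ : (thetaIndex (pilotDataOfK T.D T.K)).Fibre (.inr ⟨7, by norm_num⟩),
      (absRamificationIdx 7 (kOf (pilotDataOfK T.D T.K) 7 x₀) = 15 * l ∨ absRamificationIdx 7 (kOf (pilotDataOfK T.D T.K) 7 x₀) = 30 * l) ∧
      ¬ 7 ∣ absRamificationIdx 7 (kOf (pilotDataOfK T.D T.K) 7 x₀) := by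
  letI := T.instFieldF; letI := T.instNumberFieldF; letI := T.instAlgebraF; letI := T.instFieldK
  letI := T.instNumberFieldK; letI := T.instAlgebraK; letI := T.instFieldFbar; letI := T.instAlgebraFbar
  letI := T.instAlgebraKFbar; letI := T.instIsElliptic
  have hp7 : Nat.Prime 7 := by norm_num
  haveI : Fact (Nat.Prime 7) := ⟨hp7⟩
  intro x₀
  have hpole := WRow.ord_jInv_frey37569208117_seven
  have hpole7 : ∀ v : HeightOneSpectrum (𝓞 ℚ), Rat.HeightOneSpectrum.natGenerator v = 7 →
      ord ℚ v (Cor22.jInv (((7 ^ 11 * 19 : ℕ) : ℚ) / (2 ^ 28 * 3 ^ 12 * 11 ^ 3 * 67 : ℕ))) < 0 := fun v hv => by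
    rw [hpole v hv]; norm_num
  have hpole' : ∀ v : HeightOneSpectrum (𝓞 ℚ), Rat.HeightOneSpectrum.natGenerator v = ((⟨7, hp7⟩ : Nat.Primes) : ℕ) →
      ord ℚ v (Cor22.jInv (((7 ^ 11 * 19 : ℕ) : ℚ) / (2 ^ 28 * 3 ^ 12 * 11 ^ 3 * 67 : ℕ))) < 0 := fun v hv => hpole7 v hv
  have hl2 : ((⟨7, hp7⟩ : Nat.Primes) : ℕ) ≠ 2 := by norm_num
  have hlp : ((⟨7, hp7⟩ : Nat.Primes) : ℕ) ≠ l := fun h => hl7 h.symm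
  -- lower bound `15·l ∣ e·11` (abc-iut-W-neg-1)
  have h15 : 15 * l ∣ absRamificationIdx 7 (kOf (pilotDataOfK T.D T.K) 7 x₀) * 11 :=
    GenuineK.fifteen_mul_prime_dvd_absRamificationIdx_kOf_mul_ratPoint T ⟨7, hp7⟩ hl2 hlp (t := 11) (by norm_num)
      (fun v hv => hpole v hv) x₀
  -- upper bound `e ∣ 30·l` (abc-iut-W-neg-1) and `7 ∤ e`
  have hnot : (7 : ℕ) ∉ ({2, 3, 5, l} : Finset ℕ) := by
    simp only [Finset.mem_insert, Finset.mem_singleton, not_or]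
    exact ⟨by norm_num, by norm_num, by norm_num, fun h => hl7 h.symm⟩
  have hpw : ((7 : ℕ) : 𝓞 T.K) ∈ (placeOf (pilotDataOfK T.D T.K) 7 x₀).asIdeal := natCast_mem_placeOf (pilotDataOfK T.D T.K) 7 x₀
  have hwchar : residueChar T.K (placeOf (pilotDataOfK T.D T.K) 7 x₀) = 7 := residueChar_eq_of_natCast_mem 7 hpw
  have hdvd : (placeOf (pilotDataOfK T.D T.K) 7 x₀).asIdeal.ramificationIdx ℤ ∣ 30 * l :=
    T.ramificationIdx_int_dvd_thirty_mul_ratPoint' hnot hpole7 _ hwchar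
  have heK : absRamificationIdx 7 (kOf (pilotDataOfK T.D T.K) 7 x₀) = (placeOf (pilotDataOfK T.D T.K) 7 x₀).asIdeal.ramificationIdx ℤ :=
    absRamificationIdx_rescaledCompletion T.K 7 _ hpw
  rw [← heK] at hdvd
  obtain ⟨-, hndvd⟩ := GenuineK.absRamificationIdx_kOf_dvd_ratPoint T ⟨7, hp7⟩ hl2 (by norm_num) (by norm_num) hlp hpole' x₀
  refine ⟨?_, hndvd⟩
  have hcop : Nat.Coprime (15 * l) 11 :=
    Nat.Coprime.mul_left (by norm_num) ((Nat.coprime_primes hl (by norm_num)).mpr hl11)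
  obtain ⟨k, hk⟩ := hcop.dvd_of_dvd_mul_right h15
  have hk2 : k ∣ 2 := by
    have h1 : 15 * l * k ∣ 15 * l * 2 := by
      rw [← hk, show 15 * l * 2 = 30 * l by ring]; exact hdvd
    exact Nat.dvd_of_mul_dvd_mul_left (by have := hl.pos; omega) h1
  rcases (Nat.dvd_prime Nat.prime_two).mp hk2 with rfl | rfl
  · left; rw [hk]; ring
  · right; rw [hk]; ring

/-! ## §2. `l = 1019`, no twist factor at `7` (`e = 15·l`): S_H REFUTED at the top label over `7` -/

/-- The arithmetic of the deciding packet `(p, j) = (7, 509)` at `e = 15·1019 = 15285`, `P_q = 165`: R-H row 4's column FAILS at the certified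
radii `r_in ≤ ⌊e/6⌋ + 1 = 2548`, `r_out ≥ 7⁵ − 5e = −59618`. [folklore] -/
theorem WRow.not_hullCell_frey37569208117_gap1019 :
    ¬ HullCell ((15285 : ℕ) : ℤ) ((165 : ℕ) : ℤ) (((508 : ℕ) : ℤ) + 1) ((15285 / (7 - 1) + 1 : ℕ) : ℤ)
      (((7 : ℕ) : ℤ) ^ 5 - ((5 : ℕ) : ℤ) * ((15285 : ℕ) : ℤ)) := by
  unfold HullCell
  norm_num

/-- **«W:GAP-1019», REFUTED SUB-CLASS: `7¹¹·19 + 5¹²·1019·7151² = 2²⁸·3¹²·11³·67` at `l = 1019`, data with NO twist factor at `7`.** For every genuine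
Θ-volume datum `T` at `(ratPoint (7¹¹·19/c), 1019)` whose places over `7` have `e(K_x/ℚ₇) ∣ 15·1019` (equivalently `= 15·1019`, §1) and every pair
of Θ- and q-ideles realising the pilot divisors of `X := pilotDataOfK T.D T.K`: abc-iut-c312-1's `Thm311ToCor312.Licence` FAILS at abc-iut-c312-7's
`settingPrVolSharp X …` — `WRow.not_licence_triple_of_not_hullCell` at `(p, e₀, P, i, a₀) = (7, 15285, 165, 508, 5)`.
[cite: Mochizuki2012, IUTchI Ex. 3.2 (iv) p. 71; IUTchIII Cor. 3.12 Step (xi-f) p. 184; IUTchIV Prop. 1.1 p. 9, Prop. 1.2 (i)(ii) p. 10, Cor. 2.2 (ii) proof (P5) p. 46]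
[cite: DupuyHilado2025, §3.4, §4.9, §4.12] [claim: Mochizuki2012, status: disputed] -/
theorem WRow.not_licence_frey37569208117_gap1019_of_fifteen
    (T : Cor22.ThetaVolumeDatumAt (ratPoint (((7 ^ 11 * 19 : ℕ) : ℚ) / (2 ^ 28 * 3 ^ 12 * 11 ^ 3 * 67 : ℕ))) 1019)
    (hloc : letI := T.instFieldF; letI := T.instNumberFieldF; letI := T.instAlgebraF; letI := T.instFieldK
      letI := T.instNumberFieldK; letI := T.instAlgebraK; letI := T.instFieldFbar; letI := T.instAlgebraFbar
      letI := T.instAlgebraKFbar; letI := T.instIsElliptic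
      haveI : Fact (Nat.Prime 7) := ⟨by norm_num⟩
      ∀ x₀ : (thetaIndex (pilotDataOfK T.D T.K)).Fibre (.inr ⟨7, by norm_num⟩),
        absRamificationIdx 7 (kOf (pilotDataOfK T.D T.K) 7 x₀) ∣ 15 * 1019) :
    letI := T.instFieldF; letI := T.instNumberFieldF; letI := T.instAlgebraF; letI := T.instFieldK
    letI := T.instNumberFieldK; letI := T.instAlgebraK; letI := T.instFieldFbar; letI := T.instAlgebraFbar
    letI := T.instAlgebraKFbar; letI := T.instIsElliptic
    ∀ {logv : PadicLogs T.K} (hlog : LogvAnalytic logv) (M : Type) [Field M] [NumberField M]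
      (archPk : ∀ (j : (thetaIndex (pilotDataOfK T.D T.K)).Label) (vQ : (thetaIndex (pilotDataOfK T.D T.K)).VQ),
        Set ((logShellsDH (pilotDataOfK T.D T.K) logv).Packet j vQ))
      (archSub : ∀ (j : (thetaIndex (pilotDataOfK T.D T.K)).Label) (v : (thetaIndex (pilotDataOfK T.D T.K)).V),
        Set ((logShellsDH (pilotDataOfK T.D T.K) logv).Packet j ((thetaIndex (pilotDataOfK T.D T.K)).over v)))
      (Ψ : ℤ → ∀ v : (thetaIndex (pilotDataOfK T.D T.K)).V, v ∈ (thetaIndex (pilotDataOfK T.D T.K)).Vbad →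
        Set ((logShellsDH (pilotDataOfK T.D T.K) logv).StarPacket v))
      (act : ℤ → ∀ v : (thetaIndex (pilotDataOfK T.D T.K)).V, v ∈ (thetaIndex (pilotDataOfK T.D T.K)).Vbad →
        (logShellsDH (pilotDataOfK T.D T.K) logv).StarPacket v → Module.End ℚ ((logShellsDH (pilotDataOfK T.D T.K) logv).StarPacket v))
      (Mmod : ℤ → ∀ j : (thetaIndex (pilotDataOfK T.D T.K)).LabelStar, Set ((logShellsDH (pilotDataOfK T.D T.K) logv).GlobalPacket j.1))
      (region : ℤ → ∀ j : (thetaIndex (pilotDataOfK T.D T.K)).LabelStar, FinDivisor M → ∀ vQ : (thetaIndex (pilotDataOfK T.D T.K)).VQ,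
        Set ((logShellsDH (pilotDataOfK T.D T.K) logv).Packet j.1 vQ))
      (n : ℤ) {HT : Type} {LogLink : HT → HT → Type} {IsFull : ∀ {s t : HT}, LogLink s t → Prop}
      (lat : LGPGaussianLogThetaLattice LogLink IsFull)
      {Frd : Type} {IsoF : Frd → Frd → Type} {Ob : Frd → Type} {realify : Frd → Frd} {Strip : Type}
      {IsoS : Strip → Strip → Type} {Mv : ∀ v : (thetaIndex (pilotDataOfK T.D T.K)).V, v ∈ (thetaIndex (pilotDataOfK T.D T.K)).Vbad → Type}
      [∀ v h, Monoid (Mv v h)]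
      (sig : GlobalLGPFrobenioidSignature (thetaIndex (pilotDataOfK T.D T.K)).lstar (thetaIndex (pilotDataOfK T.D T.K)).V
        (· ∈ (thetaIndex (pilotDataOfK T.D T.K)).Vbad) Frd IsoF Ob realify Strip IsoS Mv)
      (split : SplittingMonoids Mv) {ObΔ : Type} {N : ∀ v : (thetaIndex (pilotDataOfK T.D T.K)).V, v ∈ (thetaIndex (pilotDataOfK T.D T.K)).Vbad → Type}
      [∀ v h, Monoid (N v h)] (qData : QPilotData ObΔ N)
      (tq : ∀ (pp : Nat.Primes) (x : (thetaIndex (pilotDataOfK T.D T.K)).Fibre (.inr pp)),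
        haveI : Fact (pp : ℕ).Prime := ⟨pp.2⟩; kOf (pilotDataOfK T.D T.K) pp.1 x)
      (t : ∀ (pp : Nat.Primes) (_ : Fin (pilotDataOfK T.D T.K).lstar) (x : (thetaIndex (pilotDataOfK T.D T.K)).Fibre (.inr pp)),
        haveI : Fact (pp : ℕ).Prime := ⟨pp.2⟩; kOf (pilotDataOfK T.D T.K) pp.1 x)
      (htq0 : ∀ pp x, tq pp x ≠ 0)
      (htq1 : ∀ (pp : Nat.Primes) (x : (thetaIndex (pilotDataOfK T.D T.K)).Fibre (.inr pp)),
        haveI : Fact (pp : ℕ).Prime := ⟨pp.2⟩; placeOf (pilotDataOfK T.D T.K) pp.1 x ∉ (pilotDataOfK T.D T.K).S → ‖tq pp x‖ = 1)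
      (_ht0 : ∀ pp i x, t pp i x ≠ 0)
      (_ht : ∀ (pp : Nat.Primes) (i : Fin (pilotDataOfK T.D T.K).lstar) (x : (thetaIndex (pilotDataOfK T.D T.K)).Fibre (.inr pp)),
        haveI : Fact (pp : ℕ).Prime := ⟨pp.2⟩
        Real.log ‖t pp i x‖ = -((pilotDataOfK T.D T.K).thetaPilot i (placeOf (pilotDataOfK T.D T.K) pp.1 x)) *
          logNorm T.K (placeOf (pilotDataOfK T.D T.K) pp.1 x) / localDegree T.K (placeOf (pilotDataOfK T.D T.K) pp.1 x))
      (_htq : ∀ (pp : Nat.Primes) (x : (thetaIndex (pilotDataOfK T.D T.K)).Fibre (.inr pp)),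
        haveI : Fact (pp : ℕ).Prime := ⟨pp.2⟩
        Real.log ‖tq pp x‖ = -((pilotDataOfK T.D T.K).qPilot (placeOf (pilotDataOfK T.D T.K) pp.1 x)) *
          logNorm T.K (placeOf (pilotDataOfK T.D T.K) pp.1 x) / localDegree T.K (placeOf (pilotDataOfK T.D T.K) pp.1 x)),
      ¬ Thm311ToCor312.Licence
        (settingPrVolSharp (pilotDataOfK T.D T.K) hlog M archPk archSub Ψ act Mmod region n lat sig split qData tq t htq0 htq1) := by
  letI := T.instFieldF; letI := T.instNumberFieldF; letI := T.instAlgebraF; letI := T.instFieldK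
  letI := T.instNumberFieldK; letI := T.instAlgebraK; letI := T.instFieldFbar; letI := T.instAlgebraFbar
  letI := T.instAlgebraKFbar; letI := T.instIsElliptic
  intro logv hlog M _ _ archPk archSub Ψ act Mmod region n HT LogLink IsFull lat Frd IsoF Ob realify Strip
    IsoS Mv _ sig split ObΔ N _ qData tq t htq0 htq1 ht0 ht htq
  have hp7 : Nat.Prime 7 := by norm_num
  have hloc' : letI := T.instFieldF; letI := T.instNumberFieldF; letI := T.instAlgebraF; letI := T.instFieldK
      letI := T.instNumberFieldK; letI := T.instAlgebraK; letI := T.instFieldFbar; letI := T.instAlgebraFbar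
      letI := T.instAlgebraKFbar; letI := T.instIsElliptic
      haveI : Fact (Nat.Prime 7) := ⟨hp7⟩
      ∀ x₀ : (thetaIndex (pilotDataOfK T.D T.K)).Fibre (.inr ⟨7, hp7⟩),
        absRamificationIdx 7 (kOf (pilotDataOfK T.D T.K) 7 x₀) = 15285 := by
    intro x₀
    obtain ⟨h | h, -⟩ := WRow.localType_seven_frey37569208117 (by norm_num) (by norm_num) (by norm_num) T x₀
    · rw [h]
    · exfalso
      have h2 := hloc x₀
      rw [h] at h2
      exact absurd (Nat.le_of_dvd (by norm_num) h2) (by norm_num)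
  exact WRow.not_licence_triple_of_not_hullCell isABCTriple_frey37569208117 T ⟨7, hp7⟩ (by norm_num) (by norm_num)
    (by show (7 : ℕ) ∣ _; norm_num) (e₀ := 15285) (P := 165) (i := 508) (a₀ := 5)
    (by norm_num) hloc' (by rw [WRow.factorization_frey37569208117_seven]) (by norm_num)
    (fun t ht => by interval_cases t <;> norm_num) (by norm_num) WRow.not_hullCell_frey37569208117_gap1019 hlog M archPk archSub Ψ
    act Mmod region n lat sig split qData tq t htq0 htq1 ht0 ht htq


/-- **… hence branch C's per-datum antecedent «∃ ρ qK, QPinned ∧ PilotKummerCompatHull» FAILS** at every genuine Θ-volume datum over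
`(ratPoint (7¹¹·19/c), 1019)` with no twist factor at `7`, for ANY columns `col` and EVERY pair of realising ideles (the CHOSEN ones of the window
certificates' `hSHw`/`hSHwBad` binders included) — `WRow.not_exists_qPinned_and_hull_triple_of_not_hullCell`.
[cite: Mochizuki2012, IUTchIII Cor. 3.12 Step (xi-d) p. 183, (xi-f) p. 184] [cite: DupuyHilado2025, §3.4, §4.9, §4.12] [claim: Mochizuki2012, status: disputed] -/
theorem WRow.not_exists_qPinned_and_hull_frey37569208117_gap1019_of_fifteen
    (T : Cor22.ThetaVolumeDatumAt (ratPoint (((7 ^ 11 * 19 : ℕ) : ℚ) / (2 ^ 28 * 3 ^ 12 * 11 ^ 3 * 67 : ℕ))) 1019)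
    (hloc : letI := T.instFieldF; letI := T.instNumberFieldF; letI := T.instAlgebraF; letI := T.instFieldK
      letI := T.instNumberFieldK; letI := T.instAlgebraK; letI := T.instFieldFbar; letI := T.instAlgebraFbar
      letI := T.instAlgebraKFbar; letI := T.instIsElliptic
      haveI : Fact (Nat.Prime 7) := ⟨by norm_num⟩
      ∀ x₀ : (thetaIndex (pilotDataOfK T.D T.K)).Fibre (.inr ⟨7, by norm_num⟩),
        absRamificationIdx 7 (kOf (pilotDataOfK T.D T.K) 7 x₀) ∣ 15 * 1019) :
    letI := T.instFieldF; letI := T.instNumberFieldF; letI := T.instAlgebraF; letI := T.instFieldK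
    letI := T.instNumberFieldK; letI := T.instAlgebraK; letI := T.instFieldFbar; letI := T.instAlgebraFbar
    letI := T.instAlgebraKFbar; letI := T.instIsElliptic
    ∀ {logv : PadicLogs T.K} (hlog : LogvAnalytic logv) (M : Type) [Field M] [NumberField M]
      (archPk : ∀ (j : (thetaIndex (pilotDataOfK T.D T.K)).Label) (vQ : (thetaIndex (pilotDataOfK T.D T.K)).VQ),
        Set ((logShellsDH (pilotDataOfK T.D T.K) logv).Packet j vQ))
      (archSub : ∀ (j : (thetaIndex (pilotDataOfK T.D T.K)).Label) (v : (thetaIndex (pilotDataOfK T.D T.K)).V),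
        Set ((logShellsDH (pilotDataOfK T.D T.K) logv).Packet j ((thetaIndex (pilotDataOfK T.D T.K)).over v)))
      (Ψ : ℤ → ∀ v : (thetaIndex (pilotDataOfK T.D T.K)).V, v ∈ (thetaIndex (pilotDataOfK T.D T.K)).Vbad →
        Set ((logShellsDH (pilotDataOfK T.D T.K) logv).StarPacket v))
      (act : ℤ → ∀ v : (thetaIndex (pilotDataOfK T.D T.K)).V, v ∈ (thetaIndex (pilotDataOfK T.D T.K)).Vbad →
        (logShellsDH (pilotDataOfK T.D T.K) logv).StarPacket v → Module.End ℚ ((logShellsDH (pilotDataOfK T.D T.K) logv).StarPacket v))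
      (Mmod : ℤ → ∀ j : (thetaIndex (pilotDataOfK T.D T.K)).LabelStar, Set ((logShellsDH (pilotDataOfK T.D T.K) logv).GlobalPacket j.1))
      (region : ℤ → ∀ j : (thetaIndex (pilotDataOfK T.D T.K)).LabelStar, FinDivisor M → ∀ vQ : (thetaIndex (pilotDataOfK T.D T.K)).VQ,
        Set ((logShellsDH (pilotDataOfK T.D T.K) logv).Packet j.1 vQ))
      (n : ℤ) {HT : Type} {LogLink : HT → HT → Type} {IsFull : ∀ {s t : HT}, LogLink s t → Prop}
      (lat : LGPGaussianLogThetaLattice LogLink IsFull)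
      {Frd : Type} {IsoF : Frd → Frd → Type} {Ob : Frd → Type} {realify : Frd → Frd} {Strip : Type}
      {IsoS : Strip → Strip → Type} {Mv : ∀ v : (thetaIndex (pilotDataOfK T.D T.K)).V, v ∈ (thetaIndex (pilotDataOfK T.D T.K)).Vbad → Type}
      [∀ v h, Monoid (Mv v h)]
      (sig : GlobalLGPFrobenioidSignature (thetaIndex (pilotDataOfK T.D T.K)).lstar (thetaIndex (pilotDataOfK T.D T.K)).V
        (· ∈ (thetaIndex (pilotDataOfK T.D T.K)).Vbad) Frd IsoF Ob realify Strip IsoS Mv)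
      (split : SplittingMonoids Mv) {ObΔ : Type} {N : ∀ v : (thetaIndex (pilotDataOfK T.D T.K)).V, v ∈ (thetaIndex (pilotDataOfK T.D T.K)).Vbad → Type}
      [∀ v h, Monoid (N v h)] (qData : QPilotData ObΔ N)
      (tq : ∀ (pp : Nat.Primes) (x : (thetaIndex (pilotDataOfK T.D T.K)).Fibre (.inr pp)),
        haveI : Fact (pp : ℕ).Prime := ⟨pp.2⟩; kOf (pilotDataOfK T.D T.K) pp.1 x)
      (t : ∀ (pp : Nat.Primes) (_ : Fin (pilotDataOfK T.D T.K).lstar) (x : (thetaIndex (pilotDataOfK T.D T.K)).Fibre (.inr pp)),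
        haveI : Fact (pp : ℕ).Prime := ⟨pp.2⟩; kOf (pilotDataOfK T.D T.K) pp.1 x)
      (htq0 : ∀ pp x, tq pp x ≠ 0)
      (htq1 : ∀ (pp : Nat.Primes) (x : (thetaIndex (pilotDataOfK T.D T.K)).Fibre (.inr pp)),
        haveI : Fact (pp : ℕ).Prime := ⟨pp.2⟩; placeOf (pilotDataOfK T.D T.K) pp.1 x ∉ (pilotDataOfK T.D T.K).S → ‖tq pp x‖ = 1)
      (col : ℤ → Column (logShellsDH (pilotDataOfK T.D T.K) logv))
      (_ht0 : ∀ pp i x, t pp i x ≠ 0)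
      (_ht : ∀ (pp : Nat.Primes) (i : Fin (pilotDataOfK T.D T.K).lstar) (x : (thetaIndex (pilotDataOfK T.D T.K)).Fibre (.inr pp)),
        haveI : Fact (pp : ℕ).Prime := ⟨pp.2⟩
        Real.log ‖t pp i x‖ = -((pilotDataOfK T.D T.K).thetaPilot i (placeOf (pilotDataOfK T.D T.K) pp.1 x)) *
          logNorm T.K (placeOf (pilotDataOfK T.D T.K) pp.1 x) / localDegree T.K (placeOf (pilotDataOfK T.D T.K) pp.1 x))
      (_htq : ∀ (pp : Nat.Primes) (x : (thetaIndex (pilotDataOfK T.D T.K)).Fibre (.inr pp)),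
        haveI : Fact (pp : ℕ).Prime := ⟨pp.2⟩
        Real.log ‖tq pp x‖ = -((pilotDataOfK T.D T.K).qPilot (placeOf (pilotDataOfK T.D T.K) pp.1 x)) *
          logNorm T.K (placeOf (pilotDataOfK T.D T.K) pp.1 x) / localDegree T.K (placeOf (pilotDataOfK T.D T.K) pp.1 x)),
      ¬ ∃ (ρ : (∀ v : (thetaIndex (pilotDataOfK T.D T.K)).V, v ∈ (thetaIndex (pilotDataOfK T.D T.K)).Vbad →
              Set ((logShellsDH (pilotDataOfK T.D T.K) logv).StarPacket v)) →
            ∀ (j : (thetaIndex (pilotDataOfK T.D T.K)).Label) (vQ : (thetaIndex (pilotDataOfK T.D T.K)).VQ),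
              Set ((logShellsDH (pilotDataOfK T.D T.K) logv).Packet j vQ))
          (qK : ∀ v : (thetaIndex (pilotDataOfK T.D T.K)).V, v ∈ (thetaIndex (pilotDataOfK T.D T.K)).Vbad →
            Set ((logShellsDH (pilotDataOfK T.D T.K) logv).StarPacket v)),
          QPinned ({ toSituation := situationPrVol (pilotDataOfK T.D T.K) hlog M archPk archSub Ψ act Mmod region, col := col } :
              LatticeSituation (thetaIndex (pilotDataOfK T.D T.K)))
            (settingPrVolSharp (pilotDataOfK T.D T.K) hlog M archPk archSub Ψ act Mmod region n lat sig split qData tq t htq0 htq1) ρ qK ∧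
          PilotKummerCompatHull ({ toSituation := situationPrVol (pilotDataOfK T.D T.K) hlog M archPk archSub Ψ act Mmod region, col := col } :
              LatticeSituation (thetaIndex (pilotDataOfK T.D T.K)))
            (settingPrVolSharp (pilotDataOfK T.D T.K) hlog M archPk archSub Ψ act Mmod region n lat sig split qData tq t htq0 htq1) ρ qK := by
  letI := T.instFieldF; letI := T.instNumberFieldF; letI := T.instAlgebraF; letI := T.instFieldK
  letI := T.instNumberFieldK; letI := T.instAlgebraK; letI := T.instFieldFbar; letI := T.instAlgebraFbar
  letI := T.instAlgebraKFbar; letI := T.instIsElliptic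
  intro logv hlog M _ _ archPk archSub Ψ act Mmod region n HT LogLink IsFull lat Frd IsoF Ob realify Strip
    IsoS Mv _ sig split ObΔ N _ qData tq t htq0 htq1 col ht0 ht htq h
  have hL := (exists_qPinned_and_hull_settingPrVolSharp_iff_licence (pilotDataOfK T.D T.K) hlog M archPk archSub Ψ act Mmod region n
    lat sig split qData tq t htq0 htq1 col (fun pp x => norm_qIdele_le_one_of_realises (pilotDataOfK T.D T.K) tq htq0 htq pp x)).1 h
  exact WRow.not_licence_frey37569208117_gap1019_of_fifteen T hloc hlog M archPk archSub Ψ act Mmod region n lat sig split qData tq t htq0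
    htq1 ht0 ht htq hL

/-- **… and in the instance shape of the W-lane refutations** (`GenuineK.not_pilotKummerCompatHull_chosen_frey37569208117{,_band}` of abc-iut-w5-d107,
p464927 / the band `15 ≤ l ≤ 480`; here the gap level `l = 1019`): for every genuine Θ-volume datum `T` over `(ratPoint (7¹¹·19/c), 1019)` with no
twist factor at `7` and EVERY choice of the free context binders and Kummer datum, `Cor312Vol.PilotKummerCompatHull` at `settingPrVolSharp
(pilotDataOfK T.D T.K) …` with the CHOSEN realising ideles and the PINNED reading FAILS (abc-iut-c312-1's `licence_of_pilotKummerCompatHull`).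
[cite: Mochizuki2012, IUTchIII Cor. 3.12 Step (xi-f) p. 184; IUTchIV Prop. 1.1 p. 9, Prop. 1.2 (i)(ii) p. 10] [cite: DupuyHilado2025, §3.4, §4.9, §4.12]
[claim: Mochizuki2012, status: disputed] -/
theorem GenuineK.not_pilotKummerCompatHull_chosen_frey37569208117_gap1019_of_fifteen
    (T : Cor22.ThetaVolumeDatumAt (ratPoint (((7 ^ 11 * 19 : ℕ) : ℚ) / (2 ^ 28 * 3 ^ 12 * 11 ^ 3 * 67 : ℕ))) 1019)
    (hloc : letI := T.instFieldF; letI := T.instNumberFieldF; letI := T.instAlgebraF; letI := T.instFieldK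
      letI := T.instNumberFieldK; letI := T.instAlgebraK; letI := T.instFieldFbar; letI := T.instAlgebraFbar
      letI := T.instAlgebraKFbar; letI := T.instIsElliptic
      haveI : Fact (Nat.Prime 7) := ⟨by norm_num⟩
      ∀ x₀ : (thetaIndex (pilotDataOfK T.D T.K)).Fibre (.inr ⟨7, by norm_num⟩),
        absRamificationIdx 7 (kOf (pilotDataOfK T.D T.K) 7 x₀) ∣ 15 * 1019) :
    letI := T.instFieldF; letI := T.instNumberFieldF; letI := T.instAlgebraF; letI := T.instFieldK
    letI := T.instNumberFieldK; letI := T.instAlgebraK; letI := T.instFieldFbar; letI := T.instAlgebraFbar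
    letI := T.instAlgebraKFbar; letI := T.instIsElliptic
    ∀ (M : Type) [Field M] [NumberField M]
      (archPk : ∀ (j : (thetaIndex (pilotDataOfK T.D T.K)).Label) (vQ : (thetaIndex (pilotDataOfK T.D T.K)).VQ),
        Set ((logShellsDH (pilotDataOfK T.D T.K) (analyticLogv T.K)).Packet j vQ))
      (archSub : ∀ (j : (thetaIndex (pilotDataOfK T.D T.K)).Label) (v : (thetaIndex (pilotDataOfK T.D T.K)).V),
        Set ((logShellsDH (pilotDataOfK T.D T.K) (analyticLogv T.K)).Packet j ((thetaIndex (pilotDataOfK T.D T.K)).over v)))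
      (Ψ : ℤ → ∀ v : (thetaIndex (pilotDataOfK T.D T.K)).V, v ∈ (thetaIndex (pilotDataOfK T.D T.K)).Vbad →
        Set ((logShellsDH (pilotDataOfK T.D T.K) (analyticLogv T.K)).StarPacket v))
      (act : ℤ → ∀ v : (thetaIndex (pilotDataOfK T.D T.K)).V, v ∈ (thetaIndex (pilotDataOfK T.D T.K)).Vbad →
        (logShellsDH (pilotDataOfK T.D T.K) (analyticLogv T.K)).StarPacket v →
          Module.End ℚ ((logShellsDH (pilotDataOfK T.D T.K) (analyticLogv T.K)).StarPacket v))
      (Mmod : ℤ → ∀ j : (thetaIndex (pilotDataOfK T.D T.K)).LabelStar,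
        Set ((logShellsDH (pilotDataOfK T.D T.K) (analyticLogv T.K)).GlobalPacket j.1))
      (region : ℤ → ∀ j : (thetaIndex (pilotDataOfK T.D T.K)).LabelStar, FinDivisor M →
        ∀ vQ : (thetaIndex (pilotDataOfK T.D T.K)).VQ, Set ((logShellsDH (pilotDataOfK T.D T.K) (analyticLogv T.K)).Packet j.1 vQ))
      (frobAdm : ℤ → ℤ → ∀ (j : (thetaIndex (pilotDataOfK T.D T.K)).Label) (vQ : (thetaIndex (pilotDataOfK T.D T.K)).VQ),
        Set ((logShellsDH (pilotDataOfK T.D T.K) (analyticLogv T.K)).Packet j vQ) → Prop)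
      (frobLogvol : ℤ → ℤ → ∀ (j : (thetaIndex (pilotDataOfK T.D T.K)).Label) (vQ : (thetaIndex (pilotDataOfK T.D T.K)).VQ),
        Set ((logShellsDH (pilotDataOfK T.D T.K) (analyticLogv T.K)).Packet j vQ) → ℝ)
      (frobΨ : ℤ → ℤ → ∀ v : (thetaIndex (pilotDataOfK T.D T.K)).V, v ∈ (thetaIndex (pilotDataOfK T.D T.K)).Vbad →
        Set ((logShellsDH (pilotDataOfK T.D T.K) (analyticLogv T.K)).StarPacket v))
      (frobMmod : ℤ → ℤ → ∀ j : (thetaIndex (pilotDataOfK T.D T.K)).LabelStar,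
        Set ((logShellsDH (pilotDataOfK T.D T.K) (analyticLogv T.K)).GlobalPacket j.1))
      (unitImage : ℤ → ℤ → ℕ → ∀ (j : (thetaIndex (pilotDataOfK T.D T.K)).Label) (vQ : (thetaIndex (pilotDataOfK T.D T.K)).VQ),
        Set ((logShellsDH (pilotDataOfK T.D T.K) (analyticLogv T.K)).Packet j vQ))
      (ballImage : ℤ → ℤ → ∀ (j : (thetaIndex (pilotDataOfK T.D T.K)).Label) (vQ : (thetaIndex (pilotDataOfK T.D T.K)).VQ),
        Set ((logShellsDH (pilotDataOfK T.D T.K) (analyticLogv T.K)).Packet j vQ))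
      (thetaDiv : ℤ → ℤ → LgpDivisor M (thetaIndex (pilotDataOfK T.D T.K)).lstar)
      (n : ℤ) {HT : Type} {LogLink : HT → HT → Type} {IsFull : ∀ {s t : HT}, LogLink s t → Prop}
      (lat : LGPGaussianLogThetaLattice LogLink IsFull)
      {Frd : Type} {IsoF : Frd → Frd → Type} {Ob : Frd → Type} {realify : Frd → Frd} {Strip : Type}
      {IsoS : Strip → Strip → Type} {Mv : ∀ v : (thetaIndex (pilotDataOfK T.D T.K)).V, v ∈ (thetaIndex (pilotDataOfK T.D T.K)).Vbad → Type}
      [∀ v h, Monoid (Mv v h)]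
      (sig : GlobalLGPFrobenioidSignature (thetaIndex (pilotDataOfK T.D T.K)).lstar (thetaIndex (pilotDataOfK T.D T.K)).V
        (· ∈ (thetaIndex (pilotDataOfK T.D T.K)).Vbad) Frd IsoF Ob realify Strip IsoS Mv)
      (split : SplittingMonoids Mv) {ObΔ : Type}
      {N : ∀ v : (thetaIndex (pilotDataOfK T.D T.K)).V, v ∈ (thetaIndex (pilotDataOfK T.D T.K)).Vbad → Type}
      [∀ v h, Monoid (N v h)] (qData : QPilotData ObΔ N)
      (qK : ∀ v : (thetaIndex (pilotDataOfK T.D T.K)).V, v ∈ (thetaIndex (pilotDataOfK T.D T.K)).Vbad →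
        Set ((logShellsDH (pilotDataOfK T.D T.K) (analyticLogv T.K)).StarPacket v)),
    ¬ Cor312Vol.PilotKummerCompatHull
        (LatticeSituation.ofShells (logShellsDH (pilotDataOfK T.D T.K) (analyticLogv T.K)) M archPk archSub
          (summandPiecesPr (pilotDataOfK T.D T.K) (logvAnalytic_analyticLogv (F := T.K))).Adm
          (summandPiecesPr (pilotDataOfK T.D T.K) (logvAnalytic_analyticLogv (F := T.K))).logvol Ψ act Mmod region frobAdm
          frobLogvol frobΨ frobMmod unitImage ballImage thetaDiv)
        (settingPrVolSharp (pilotDataOfK T.D T.K) (logvAnalytic_analyticLogv (F := T.K)) M archPk archSub Ψ act Mmod region n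
          lat sig split qData (exists_realising_qIdeles_pilotDataOfK T.D).choose (exists_realising_thetaIdeles_pilotDataOfK T.D).choose
          (exists_realising_qIdeles_pilotDataOfK T.D).choose_spec.1 (exists_realising_qIdeles_pilotDataOfK T.D).choose_spec.2.1)
        (fun _ => Cor312.Setting.qRegion
          (settingPrVolSharp (pilotDataOfK T.D T.K) (logvAnalytic_analyticLogv (F := T.K)) M archPk archSub Ψ act Mmod region n
            lat sig split qData (exists_realising_qIdeles_pilotDataOfK T.D).choose (exists_realising_thetaIdeles_pilotDataOfK T.D).choose
            (exists_realising_qIdeles_pilotDataOfK T.D).choose_spec.1 (exists_realising_qIdeles_pilotDataOfK T.D).choose_spec.2.1))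
        qK := by
  letI := T.instFieldF; letI := T.instNumberFieldF; letI := T.instAlgebraF; letI := T.instFieldK
  letI := T.instNumberFieldK; letI := T.instAlgebraK; letI := T.instFieldFbar; letI := T.instAlgebraFbar
  letI := T.instAlgebraKFbar; letI := T.instIsElliptic
  intro M _ _ archPk archSub Ψ act Mmod region frobAdm frobLogvol frobΨ frobMmod
    unitImage ballImage thetaDiv n HT LogLink IsFull lat Frd IsoF Ob realify Strip IsoS Mv _ sig split ObΔ N _ qData qK hSH
  have hL := licence_of_pilotKummerCompatHull (hq := fun _ _ => rfl) (hc := hSH)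
  exact WRow.not_licence_frey37569208117_gap1019_of_fifteen T hloc (logvAnalytic_analyticLogv (F := T.K)) M archPk archSub Ψ act Mmod
    region n lat sig split qData (exists_realising_qIdeles_pilotDataOfK T.D).choose (exists_realising_thetaIdeles_pilotDataOfK T.D).choose
    (exists_realising_qIdeles_pilotDataOfK T.D).choose_spec.1 (exists_realising_qIdeles_pilotDataOfK T.D).choose_spec.2.1
    (exists_realising_thetaIdeles_pilotDataOfK T.D).choose_spec.1 (exists_realising_thetaIdeles_pilotDataOfK T.D).choose_spec.2.2
    (exists_realising_qIdeles_pilotDataOfK T.D).choose_spec.2.2 hL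

end Summit.ABC.IUTFork.Conditional

end
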